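import Mathlib.LinearAlgebra.Matrix.Rank
import Literature.NumberTheory.Automorphic.UnitaryGroupDoubledSiegelGeneration
import HarnessLib

/-!
# The Bruhat decomposition of the doubled unitary group `U(𝕍 ⊕ −𝕍)` relative to its Siegel parabolic `P_Δ`

Topic `NumberTheory/Automorphic`; namespace `Literature.NumberTheory.Automorphic.DoubledUnitary` (sequel of
`UnitaryGroupDoubledSiegelGeneration`).  KERNEL only: definitions with bodies and proved lemmas; no named fact, no `sorry`.

Setting: `K` a field with a ring involution `σ` (`σ ∘ σ = id`; e.g. the quadratic extension `E_w / F_v` at a non-split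
place with its conjugation, or a CM field).  In the SPLIT MODEL `J₁ = antidiag(1, 1)` of the doubled hermitian space
(`antidiagForm 1`, basis adapted to `𝔻 = Δ ⊕ Δ⁻`) the Siegel parabolic `P = P_Δ` is the block-upper subgroup, its Levi factor
is `M = {m(α) = diag(α, σ(α)ᵀ⁻¹)} ≅ GL_n(K)`, and for a `0∕1`-diagonal idempotent `E` the PARTIAL WEYL ELEMENT
`w_E = [[1 − E, E], [E, 1 − E]]` swaps the `Δ`- and `Δ⁻`-coordinates indexed by the support of `E`.

MAIN RESULT (`exists_bruhat_antidiag_one`): **`U(σ, J₁)(K) = ⋃_E P · w_E · P`** — every `g ∈ U(σ, J₁)` is `p₁ w_E p₂` with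
`p₁, p₂ ∈ P ∩ U(σ, J₁)` and `E` a `0∕1`-diagonal matrix (whose rank is that of the lower-left block `g₂₁`); this is the
Bruhat decomposition `H = ⊔_{j=0}^{n} P w_j P` of [Kudla1994, §3] ∕ [HarrisKudlaSweet1996, §1 (1.12)–(1.14)] relative to the Siegel
parabolic of the quasi-split unitary group, stated with the coordinate representatives `w_E`.  The proof is a constructive row
reduction in the `e ∕ f = 1 − e` idempotent algebra (as in the singular case of `UnitaryGroupDoubledSiegelGeneration`): Levi factors
on both sides bring `g₂₁` to `e` (pivot normal form `Matrix.Pivot`); the isotropy relations `σ(g₂₁)ᵀ g₁₁ + σ(g₁₁)ᵀ g₂₁ = 0`, … make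
`x = −a e + e σ(a)ᵀ f` and `y = −e d + f σ(d)ᵀ e` skew, and `n(x) g n(y)` has `g₁₁ e = 0 = e g₂₂`; the explicit Levi element
`diag(e + σ(d)ᵀ, e + σ(a)ᵀ)` (inverse `diag(e + a, e + d)`) then normalises both diagonal blocks to `f`, and an element
`[[f, b], [e, f]]` of `U(σ, J₁)` IS `w_E · n(f b)`.  §4 transports the statement to the models `antidiag(τ, τ)` of
`UnitaryGroupDoubledSiegelGeneration`.

Written as the GENERIC input of brick L4b(i) of GR-1's L5 roadmap (Kudla's splitting on the doubled group: the Bruhat cells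
relative to `P_Δ` carry the invariant `j(g) = rank E`) of the kernel construction of [GelbartRogawski1991, Prop. 3.1.1] (stage-1 cell
`pub-hodgecm`, seats GR-1 ∕ GR-2; this file: seat carch-1, 2026-08-21).

## References

* S. S. Kudla, Israel J. Math. 87 (1994) 361–401, §3 [Kudla1994].
* M. Harris, S. S. Kudla, W. J. Sweet, J. Amer. Math. Soc. 9 (1996) 941–1004, §1 [HarrisKudlaSweet1996].
* A. Borel, *Linear Algebraic Groups*, 2nd ed., GTM 126 (1991), §21.15 (Bruhat decomposition over `k`) [Borel1991].
-/

set_option autoImplicit false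

noncomputable section

open scoped Matrix MatrixGroups
open Matrix

namespace Literature.NumberTheory.Automorphic

namespace DoubledUnitary

variable {K : Type*} [Field K] {ι : Type*} [Fintype ι] [DecidableEq ι] (σ : K →+* K)

/-! ## §1 The split model `J₁ = antidiag(1, 1)`: relations, Levi elements, partial Weyl elements -/

section SplitModel

omit [DecidableEq ι] in
/-- `σ`-conjugate transpose `x ↦ σ(x)ᵀ` reverses products. [folklore] -/
private theorem star_mul' (x y : Matrix ι ι K) : ((x * y).map σ)ᵀ = (y.map σ)ᵀ * (x.map σ)ᵀ := by
  rw [Matrix.map_mul, Matrix.transpose_mul]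

omit [Fintype ι] [DecidableEq ι] in
/-- `σ(σ(x)ᵀ)ᵀ = x` for an involution. [folklore] -/
private theorem star_star' (hσ : ∀ x, σ (σ x) = x) (x : Matrix ι ι K) : (((x.map σ)ᵀ).map σ)ᵀ = x := by
  ext i j; simp [hσ]

omit [Fintype ι] [DecidableEq ι] in
/-- `σ(x + y)ᵀ = σ(x)ᵀ + σ(y)ᵀ`. [folklore] -/
private theorem star_add' (x y : Matrix ι ι K) : ((x + y).map σ)ᵀ = (x.map σ)ᵀ + (y.map σ)ᵀ := by
  rw [Matrix.map_add _ (map_add σ), Matrix.transpose_add]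

omit [Fintype ι] [DecidableEq ι] in
/-- `σ(−x)ᵀ = −σ(x)ᵀ`. [folklore] -/
private theorem star_neg' (x : Matrix ι ι K) : ((-x).map σ)ᵀ = -((x.map σ)ᵀ) := by
  rw [Matrix.map_neg _ (map_neg σ), Matrix.transpose_neg]

omit [Fintype ι] [DecidableEq ι] in
/-- `σ(x − y)ᵀ = σ(x)ᵀ − σ(y)ᵀ`. [folklore] -/
private theorem star_sub' (x y : Matrix ι ι K) : ((x - y).map σ)ᵀ = (x.map σ)ᵀ - (y.map σ)ᵀ := by
  rw [Matrix.map_sub _ (map_sub σ), Matrix.transpose_sub]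

omit [Fintype ι] in
/-- `σ(1)ᵀ = 1`. [folklore] -/
private theorem star_one' : ((1 : Matrix ι ι K).map σ)ᵀ = 1 := by
  rw [Matrix.map_one σ (map_zero σ) (map_one σ), Matrix.transpose_one]

omit [Fintype ι] [DecidableEq ι] in
/-- `σ(0)ᵀ = 0`. [folklore] -/
private theorem star_zero' : ((0 : Matrix ι ι K).map σ)ᵀ = 0 := by
  rw [Matrix.map_zero σ (map_zero σ), Matrix.transpose_zero]

/-- `σ(x⁻¹)ᵀ = (σ(x)ᵀ)⁻¹` for invertible `x`. [folklore] -/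
private theorem star_inv' {x : Matrix ι ι K} (hx : IsUnit x.det) : ((x⁻¹).map σ)ᵀ = ((x.map σ)ᵀ)⁻¹ := by
  have h1 : (x⁻¹).map σ = (x.map σ)⁻¹ := by
    refine (Matrix.inv_eq_left_inv ?_).symm
    rw [← Matrix.map_mul, Matrix.nonsing_inv_mul x hx, Matrix.map_one σ (map_zero σ) (map_one σ)]
  rw [h1, Matrix.transpose_nonsing_inv]

/-- `det σ(x)ᵀ` is a unit when `det x` is. [folklore] -/
private theorem isUnit_det_star {x : Matrix ι ι K} (hx : IsUnit x.det) : IsUnit ((x.map σ)ᵀ).det := by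
  rw [Matrix.det_transpose, ← RingHom.mapMatrix_apply, ← RingHom.map_det]
  exact hx.map σ

omit [Fintype ι] in
/-- a `0∕1`-diagonal matrix is fixed by `x ↦ σ(x)ᵀ`. [folklore] -/
private theorem star_diagonal01 (χ : ι → K) (hχ : ∀ i, χ i = 0 ∨ χ i = 1) :
    ((Matrix.diagonal χ).map σ)ᵀ = Matrix.diagonal χ := by
  rw [Matrix.diagonal_map (map_zero σ), Matrix.diagonal_transpose]
  congr 1; funext i
  rcases hχ i with h | h <;> simp [h]

/-- a `0∕1`-diagonal matrix is idempotent. [folklore] -/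
private theorem diagonal01_mul_self (χ : ι → K) (hχ : ∀ i, χ i = 0 ∨ χ i = 1) :
    Matrix.diagonal χ * Matrix.diagonal χ = Matrix.diagonal χ := by
  rw [Matrix.diagonal_mul_diagonal]
  congr 1; funext i
  rcases hχ i with h | h <;> simp [h]

/-- `(1 − E)(1 − E) = 1 − E` for an idempotent `E`. [folklore] -/
private theorem compl_mul_compl {E : Matrix ι ι K} (hE : E * E = E) : (1 - E) * (1 - E) = 1 - E := by
  rw [Matrix.sub_mul, Matrix.one_mul, Matrix.mul_sub, Matrix.mul_one, hE, sub_self, sub_zero]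

/-- `(1 − E) E = 0` for an idempotent `E`. [folklore] -/
private theorem compl_mul_self {E : Matrix ι ι K} (hE : E * E = E) : (1 - E) * E = 0 := by
  rw [Matrix.sub_mul, Matrix.one_mul, hE, sub_self]

/-- `E (1 − E) = 0` for an idempotent `E`. [folklore] -/
private theorem self_mul_compl {E : Matrix ι ι K} (hE : E * E = E) : E * (1 - E) = 0 := by
  rw [Matrix.mul_sub, Matrix.mul_one, hE, sub_self]

/-- **The block relations of `U(σ, J₁)`**: for `g = [[a, b], [c, d]] ∈ U(σ, antidiag(1,1))` (with `x* := σ(x)ᵀ`):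
`c*a + a*c = 0`, `c*b + a*d = 1`, `d*a + b*c = 1`, `d*b + b*d = 0` (from `g* J g = J`) and
`a d* + b c* = 1`, `a b* + b a* = 0`, `c d* + d c* = 0`, `c b* + d a* = 1` (from `g (J g* J) = 1`).
[cite: HarrisKudlaSweet1996, §1 (1.11)] -/
theorem blocks_rel_one {g : GL (ι ⊕ ι) K} (hg : g ∈ unitaryGroupOfForm σ (antidiagForm (1 : Matrix ι ι K))) :
    let a := (g : Matrix (ι ⊕ ι) (ι ⊕ ι) K).toBlocks₁₁
    let b := (g : Matrix (ι ⊕ ι) (ι ⊕ ι) K).toBlocks₁₂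
    let c := (g : Matrix (ι ⊕ ι) (ι ⊕ ι) K).toBlocks₂₁
    let d := (g : Matrix (ι ⊕ ι) (ι ⊕ ι) K).toBlocks₂₂
    ((c.map σ)ᵀ * a + (a.map σ)ᵀ * c = 0 ∧ (c.map σ)ᵀ * b + (a.map σ)ᵀ * d = 1 ∧
      (d.map σ)ᵀ * a + (b.map σ)ᵀ * c = 1 ∧ (d.map σ)ᵀ * b + (b.map σ)ᵀ * d = 0) ∧
    (a * (d.map σ)ᵀ + b * (c.map σ)ᵀ = 1 ∧ a * (b.map σ)ᵀ + b * (a.map σ)ᵀ = 0 ∧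
      c * (d.map σ)ᵀ + d * (c.map σ)ᵀ = 0 ∧ c * (b.map σ)ᵀ + d * (a.map σ)ᵀ = 1) := by
  intro a b c d
  rw [mem_unitaryGroupOfForm_iff] at hg
  set M := (g : Matrix (ι ⊕ ι) (ι ⊕ ι) K) with hM
  have hMblk : M = Matrix.fromBlocks a b c d := (Matrix.fromBlocks_toBlocks M).symm
  have hstar : (M.map σ)ᵀ = Matrix.fromBlocks (a.map σ)ᵀ (c.map σ)ᵀ (b.map σ)ᵀ (d.map σ)ᵀ := by
    rw [hMblk, Matrix.fromBlocks_map, Matrix.fromBlocks_transpose]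
  have hJ : antidiagForm (1 : Matrix ι ι K) = Matrix.fromBlocks 0 1 1 0 := rfl
  -- `g* J g = J`, blockwise
  have hR : Matrix.fromBlocks ((c.map σ)ᵀ * a + (a.map σ)ᵀ * c) ((c.map σ)ᵀ * b + (a.map σ)ᵀ * d)
      ((d.map σ)ᵀ * a + (b.map σ)ᵀ * c) ((d.map σ)ᵀ * b + (b.map σ)ᵀ * d) =
      Matrix.fromBlocks 0 1 1 0 := by
    have h := hg
    rw [hstar, hJ, hMblk] at h
    simpa only [Matrix.fromBlocks_multiply, Matrix.mul_zero, Matrix.mul_one, zero_add, add_zero] using h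
  obtain ⟨h11, h12, h21, h22⟩ := Matrix.fromBlocks_inj.1 hR
  -- `J g* J` is a left inverse of `g`, hence a right inverse
  have hleft : (Matrix.fromBlocks (d.map σ)ᵀ (b.map σ)ᵀ (c.map σ)ᵀ (a.map σ)ᵀ) * M = 1 := by
    rw [hMblk, Matrix.fromBlocks_multiply, h11, h12, h21, h22, Matrix.fromBlocks_one]
  have hright := mul_eq_one_comm.1 hleft
  rw [hMblk, Matrix.fromBlocks_multiply, ← Matrix.fromBlocks_one] at hright
  obtain ⟨s11, s12, s21, s22⟩ := Matrix.fromBlocks_inj.1 hright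
  exact ⟨⟨h11, h12, h21, h22⟩, ⟨s11, s12, s21, s22⟩⟩

/-- a block-diagonal element `diag(α, δ)` with explicit two-sided inverse `diag(α', δ')`. [folklore] -/
def blockDiagUnit (α δ α' δ' : Matrix ι ι K) (h₁ : α * α' = 1) (h₂ : δ * δ' = 1) (h₃ : α' * α = 1) (h₄ : δ' * δ = 1) :
    GL (ι ⊕ ι) K :=
  ⟨Matrix.fromBlocks α 0 0 δ, Matrix.fromBlocks α' 0 0 δ',
    by rw [Matrix.fromBlocks_multiply]; simp [h₁, h₂, Matrix.fromBlocks_one],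
    by rw [Matrix.fromBlocks_multiply]; simp [h₃, h₄, Matrix.fromBlocks_one]⟩

/-- underlying matrix of `blockDiagUnit`. [folklore] -/
@[simp] private theorem coe_blockDiagUnit (α δ α' δ' : Matrix ι ι K) (h₁ : α * α' = 1) (h₂ : δ * δ' = 1)
    (h₃ : α' * α = 1) (h₄ : δ' * δ = 1) :
    ((blockDiagUnit α δ α' δ' h₁ h₂ h₃ h₄ : GL (ι ⊕ ι) K) : Matrix (ι ⊕ ι) (ι ⊕ ι) K) = Matrix.fromBlocks α 0 0 δ := rfl

/-- `diag(α, δ) ∈ U(σ, J₁)` iff `σ(α)ᵀ δ = 1 = σ(δ)ᵀ α`. [folklore] -/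
private theorem blockDiagUnit_mem {α δ α' δ' : Matrix ι ι K} {h₁ : α * α' = 1} {h₂ : δ * δ' = 1} {h₃ : α' * α = 1}
    {h₄ : δ' * δ = 1} (hαδ : (α.map σ)ᵀ * δ = 1) (hδα : (δ.map σ)ᵀ * α = 1) :
    blockDiagUnit α δ α' δ' h₁ h₂ h₃ h₄ ∈ unitaryGroupOfForm σ (antidiagForm (1 : Matrix ι ι K)) := by
  rw [mem_unitaryGroupOfForm_iff, coe_blockDiagUnit, Matrix.fromBlocks_map, Matrix.fromBlocks_transpose]
  show _ * Matrix.fromBlocks 0 1 1 0 * _ = Matrix.fromBlocks 0 1 1 0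
  simp only [star_zero', Matrix.fromBlocks_multiply, Matrix.mul_zero, Matrix.mul_one, Matrix.zero_mul, zero_add,
    add_zero, hαδ, hδα]

/-- `diag(α, δ)` is block-upper. [folklore] -/
private theorem isBlockUpper_blockDiagUnit {α δ α' δ' : Matrix ι ι K} {h₁ : α * α' = 1} {h₂ : δ * δ' = 1}
    {h₃ : α' * α = 1} {h₄ : δ' * δ = 1} : IsBlockUpper (blockDiagUnit α δ α' δ' h₁ h₂ h₃ h₄) := by
  simp [IsBlockUpper]

/-- **Levi element with prescribed `(1,1)`-block**: `m(α) = diag(α, σ(α)ᵀ⁻¹) ∈ U(σ, J₁)`. [cite: HarrisKudlaSweet1996, §1 (1.11)] -/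
def leviUpper (α : Matrix ι ι K) (hα : IsUnit α.det) : GL (ι ⊕ ι) K :=
  blockDiagUnit α (((α.map σ)ᵀ)⁻¹) α⁻¹ ((α.map σ)ᵀ) (Matrix.mul_nonsing_inv α hα)
    (Matrix.nonsing_inv_mul _ (isUnit_det_star σ hα)) (Matrix.nonsing_inv_mul α hα)
    (Matrix.mul_nonsing_inv _ (isUnit_det_star σ hα))

/-- **Levi element with prescribed `(2,2)`-block**: `diag(σ(δ)ᵀ⁻¹, δ) ∈ U(σ, J₁)`. [cite: HarrisKudlaSweet1996, §1 (1.11)] -/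
def leviLower (δ : Matrix ι ι K) (hδ : IsUnit δ.det) : GL (ι ⊕ ι) K :=
  blockDiagUnit (((δ.map σ)ᵀ)⁻¹) δ ((δ.map σ)ᵀ) δ⁻¹ (Matrix.nonsing_inv_mul _ (isUnit_det_star σ hδ))
    (Matrix.mul_nonsing_inv δ hδ) (Matrix.mul_nonsing_inv _ (isUnit_det_star σ hδ)) (Matrix.nonsing_inv_mul δ hδ)

/-- underlying matrix of `leviUpper`. [folklore] -/
@[simp] private theorem coe_leviUpper (α : Matrix ι ι K) (hα : IsUnit α.det) :
    ((leviUpper σ α hα : GL (ι ⊕ ι) K) : Matrix (ι ⊕ ι) (ι ⊕ ι) K) = Matrix.fromBlocks α 0 0 (((α.map σ)ᵀ)⁻¹) := rfl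

/-- underlying matrix of `leviLower`. [folklore] -/
@[simp] private theorem coe_leviLower (δ : Matrix ι ι K) (hδ : IsUnit δ.det) :
    ((leviLower σ δ hδ : GL (ι ⊕ ι) K) : Matrix (ι ⊕ ι) (ι ⊕ ι) K) = Matrix.fromBlocks (((δ.map σ)ᵀ)⁻¹) 0 0 δ := rfl

/-- `m(α) ∈ U(σ, J₁)`. [cite: HarrisKudlaSweet1996, §1 (1.11)] -/
theorem leviUpper_mem (hσ : ∀ x, σ (σ x) = x) (α : Matrix ι ι K) (hα : IsUnit α.det) :
    leviUpper σ α hα ∈ unitaryGroupOfForm σ (antidiagForm (1 : Matrix ι ι K)) := by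
  refine blockDiagUnit_mem σ (Matrix.mul_nonsing_inv _ (isUnit_det_star σ hα)) ?_
  rw [star_inv' σ (isUnit_det_star σ hα), star_star' σ hσ, Matrix.nonsing_inv_mul α hα]

/-- `diag(σ(δ)ᵀ⁻¹, δ) ∈ U(σ, J₁)`. [cite: HarrisKudlaSweet1996, §1 (1.11)] -/
theorem leviLower_mem (hσ : ∀ x, σ (σ x) = x) (δ : Matrix ι ι K) (hδ : IsUnit δ.det) :
    leviLower σ δ hδ ∈ unitaryGroupOfForm σ (antidiagForm (1 : Matrix ι ι K)) := by
  refine blockDiagUnit_mem σ ?_ (Matrix.mul_nonsing_inv _ (isUnit_det_star σ hδ))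
  rw [star_inv' σ (isUnit_det_star σ hδ), star_star' σ hσ, Matrix.nonsing_inv_mul δ hδ]

/-- **The partial Weyl element `w_E = [[1 − E, E], [E, 1 − E]]`** (swap of the `Δ`∕`Δ⁻`-coordinates on the support of the
idempotent `E`); it is its own inverse. [cite: Kudla1994, §3] -/
def partialWeyl (E : Matrix ι ι K) (hE : E * E = E) : GL (ι ⊕ ι) K :=
  ⟨Matrix.fromBlocks (1 - E) E E (1 - E), Matrix.fromBlocks (1 - E) E E (1 - E),
    by
      rw [Matrix.fromBlocks_multiply, ← Matrix.fromBlocks_one]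
      simp only [compl_mul_compl hE, compl_mul_self hE, self_mul_compl hE, hE, sub_add_cancel, add_zero, add_sub_cancel],
    by
      rw [Matrix.fromBlocks_multiply, ← Matrix.fromBlocks_one]
      simp only [compl_mul_compl hE, compl_mul_self hE, self_mul_compl hE, hE, sub_add_cancel, add_zero, add_sub_cancel]⟩

/-- underlying matrix of `w_E`. [folklore] -/
@[simp] private theorem coe_partialWeyl (E : Matrix ι ι K) (hE : E * E = E) :
    ((partialWeyl E hE : GL (ι ⊕ ι) K) : Matrix (ι ⊕ ι) (ι ⊕ ι) K) = Matrix.fromBlocks (1 - E) E E (1 - E) := rfl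

/-- `w_E ∈ U(σ, J₁)` for a `σ`-hermitian idempotent `E` (e.g. a `0∕1`-diagonal matrix). [cite: Kudla1994, §3] -/
theorem partialWeyl_mem (E : Matrix ι ι K) (hE : E * E = E) (hEs : (E.map σ)ᵀ = E) :
    partialWeyl E hE ∈ unitaryGroupOfForm σ (antidiagForm (1 : Matrix ι ι K)) := by
  rw [mem_unitaryGroupOfForm_iff, coe_partialWeyl, Matrix.fromBlocks_map, Matrix.fromBlocks_transpose]
  have hs1 : (((1 : Matrix ι ι K) - E).map σ)ᵀ = 1 - E := by rw [star_sub', hEs, star_one']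
  rw [hs1, hEs]
  show _ * Matrix.fromBlocks 0 1 1 0 * _ = Matrix.fromBlocks 0 1 1 0
  simp only [Matrix.fromBlocks_multiply, Matrix.mul_zero, Matrix.mul_one, zero_add, add_zero, compl_mul_compl hE,
    compl_mul_self hE, self_mul_compl hE, hE, add_sub_cancel, sub_add_cancel]

/-- the lower-left block of `w_E` is `E` (the cell of `w_E` has Kudla's index `j = rank E`). [cite: Kudla1994, §3] -/
theorem partialWeyl_block₂₁ (E : Matrix ι ι K) (hE : E * E = E) :
    ((partialWeyl E hE : GL (ι ⊕ ι) K) : Matrix (ι ⊕ ι) (ι ⊕ ι) K).toBlocks₂₁ = E := by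
  simp

/-- `n(x) ∈ U(σ, J₁)` iff `x + σ(x)ᵀ = 0` (we only need "if"). [folklore] -/
private theorem upperUnipotent_mem_one {x : Matrix ι ι K} (hx : x + (x.map σ)ᵀ = 0) :
    upperUnipotent x ∈ unitaryGroupOfForm σ (antidiagForm (1 : Matrix ι ι K)) := by
  rw [mem_unitaryGroupOfForm_iff]
  show ((Matrix.fromBlocks 1 x 0 1 : Matrix (ι ⊕ ι) (ι ⊕ ι) K).map σ)ᵀ * Matrix.fromBlocks 0 1 1 0 *
    Matrix.fromBlocks 1 x 0 1 = Matrix.fromBlocks 0 1 1 0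
  rw [Matrix.fromBlocks_map, Matrix.fromBlocks_transpose, star_one', star_zero']
  simp only [Matrix.fromBlocks_multiply, Matrix.mul_zero, Matrix.zero_mul, Matrix.mul_one, Matrix.one_mul, zero_add,
    add_zero]
  rw [hx]

/-- `n(x)` is block-upper. [folklore] -/
private theorem isBlockUpper_upperUnipotent' (x : Matrix ι ι K) : IsBlockUpper (upperUnipotent x) := by
  show (Matrix.fromBlocks (1 : Matrix ι ι K) x 0 1).toBlocks₂₁ = 0
  rw [Matrix.toBlocks_fromBlocks₂₁]

/-- block-upper elements of `U` are closed under products and inverses (the `(2,1)`-blocks). [folklore] -/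
private theorem isBlockUpper_mul {p q : GL (ι ⊕ ι) K} (hp : IsBlockUpper p) (hq : IsBlockUpper q) : IsBlockUpper (p * q) := by
  have hp' : (p : Matrix (ι ⊕ ι) (ι ⊕ ι) K).toBlocks₂₁ = 0 := hp
  have hq' : (q : Matrix (ι ⊕ ι) (ι ⊕ ι) K).toBlocks₂₁ = 0 := hq
  show ((p * q : GL (ι ⊕ ι) K) : Matrix (ι ⊕ ι) (ι ⊕ ι) K).toBlocks₂₁ = 0
  rw [Units.val_mul, ← Matrix.fromBlocks_toBlocks (p : Matrix (ι ⊕ ι) (ι ⊕ ι) K),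
    ← Matrix.fromBlocks_toBlocks (q : Matrix (ι ⊕ ι) (ι ⊕ ι) K), Matrix.fromBlocks_multiply, hp', hq']
  simp

/-- the inverse of a block-upper invertible matrix is block-upper. [folklore] -/
private theorem isBlockUpper_inv {p : GL (ι ⊕ ι) K} (hp : IsBlockUpper p) : IsBlockUpper p⁻¹ := by
  -- `p = [[a, b], [0, d]]` with `a`, `d` invertible; `p⁻¹ = [[a⁻¹, -a⁻¹ b d⁻¹], [0, d⁻¹]]`
  have hp' : (p : Matrix (ι ⊕ ι) (ι ⊕ ι) K).toBlocks₂₁ = 0 := hp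
  set P := (p : Matrix (ι ⊕ ι) (ι ⊕ ι) K) with hP
  set Q := ((p⁻¹ : GL (ι ⊕ ι) K) : Matrix (ι ⊕ ι) (ι ⊕ ι) K) with hQ
  have hPQ : P * Q = 1 := by rw [hP, hQ, ← Units.val_mul, mul_inv_cancel, Units.val_one]
  have hQP : Q * P = 1 := by rw [hP, hQ, ← Units.val_mul, inv_mul_cancel, Units.val_one]
  have hPb : P = Matrix.fromBlocks P.toBlocks₁₁ P.toBlocks₁₂ 0 P.toBlocks₂₂ := by
    conv_lhs => rw [← Matrix.fromBlocks_toBlocks P, hp']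
  have hQb : Q = Matrix.fromBlocks Q.toBlocks₁₁ Q.toBlocks₁₂ Q.toBlocks₂₁ Q.toBlocks₂₂ := (Matrix.fromBlocks_toBlocks Q).symm
  -- from `Q P = 1`: `Q₂₁ P₁₁ = 0`; from `P Q = 1`, block (2,2): `P₂₂ Q₂₂ = 1`, so `P₁₁` … we use `(Q P)₂₁ = Q₂₁ P₁₁ = 0` and
  -- invertibility of `P₁₁` from `(P Q)₁₁ = P₁₁ Q₁₁ + P₁₂ Q₂₁ = 1` … simplest: `(Q P)₂₁ = Q₂₁ P₁₁ = 0` and `(Q P)₂₂ = Q₂₁ P₁₂ + Q₂₂ P₂₂ = 1`,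
  -- `(P Q)₂₂ = P₂₂ Q₂₂ = 1` ⇒ `Q₂₂ P₂₂ = 1` ⇒ `Q₂₁ P₁₂ = 0`; and `(P Q)₂₁ = P₂₂ Q₂₁ = 0` with `P₂₂` invertible ⇒ `Q₂₁ = 0`.
  have h1 : P.toBlocks₂₂ * Q.toBlocks₂₁ = 0 := by
    have h := hPQ
    rw [hPb, hQb, Matrix.fromBlocks_multiply, ← Matrix.fromBlocks_one] at h
    have := (Matrix.fromBlocks_inj.1 h).2.2.1
    simpa using this
  have h2 : P.toBlocks₂₂ * Q.toBlocks₂₂ = 1 := by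
    have h := hPQ
    rw [hPb, hQb, Matrix.fromBlocks_multiply, ← Matrix.fromBlocks_one] at h
    have := (Matrix.fromBlocks_inj.1 h).2.2.2
    simpa using this
  have h3 : Q.toBlocks₂₂ * P.toBlocks₂₂ = 1 := mul_eq_one_comm.1 h2
  show Q.toBlocks₂₁ = 0
  calc Q.toBlocks₂₁ = Q.toBlocks₂₂ * P.toBlocks₂₂ * Q.toBlocks₂₁ := by rw [h3, Matrix.one_mul]
    _ = 0 := by rw [Matrix.mul_assoc, h1, Matrix.mul_zero]

/-- the diagonal blocks of a block-upper invertible matrix are invertible. [folklore] -/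
private theorem isUnit_det_diag_of_isBlockUpper {p : GL (ι ⊕ ι) K} (hp : IsBlockUpper p) :
    IsUnit (p : Matrix (ι ⊕ ι) (ι ⊕ ι) K).toBlocks₁₁.det ∧ IsUnit (p : Matrix (ι ⊕ ι) (ι ⊕ ι) K).toBlocks₂₂.det := by
  have hq : IsBlockUpper p⁻¹ := isBlockUpper_inv hp
  have hp' : (p : Matrix (ι ⊕ ι) (ι ⊕ ι) K).toBlocks₂₁ = 0 := hp
  have hq' : ((p⁻¹ : GL (ι ⊕ ι) K) : Matrix (ι ⊕ ι) (ι ⊕ ι) K).toBlocks₂₁ = 0 := hq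
  set P := (p : Matrix (ι ⊕ ι) (ι ⊕ ι) K) with hP
  set Q := ((p⁻¹ : GL (ι ⊕ ι) K) : Matrix (ι ⊕ ι) (ι ⊕ ι) K) with hQ
  have hPQ : P * Q = 1 := by rw [hP, hQ, ← Units.val_mul, mul_inv_cancel, Units.val_one]
  have hPb : P = Matrix.fromBlocks P.toBlocks₁₁ P.toBlocks₁₂ 0 P.toBlocks₂₂ := by
    conv_lhs => rw [← Matrix.fromBlocks_toBlocks P, hp']
  have hQb : Q = Matrix.fromBlocks Q.toBlocks₁₁ Q.toBlocks₁₂ 0 Q.toBlocks₂₂ := by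
    conv_lhs => rw [← Matrix.fromBlocks_toBlocks Q, hq']
  rw [hPb, hQb, Matrix.fromBlocks_multiply, ← Matrix.fromBlocks_one] at hPQ
  obtain ⟨h11, -, -, h22⟩ := Matrix.fromBlocks_inj.1 hPQ
  simp only [Matrix.mul_zero, add_zero, Matrix.zero_mul, zero_add] at h11 h22
  exact ⟨Matrix.isUnit_det_of_right_inverse h11, Matrix.isUnit_det_of_right_inverse h22⟩

/-- **the Bruhat cell is an invariant of the double coset**: the lower-left block of `p₁ g p₂` (`p₁, p₂` block-upper,
invertible) has the rank of that of `g` — Kudla's index `j(g)`. [cite: Kudla1994, §3] -/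
theorem rank_block₂₁_mul_mul {p₁ p₂ : GL (ι ⊕ ι) K} (hp₁ : IsBlockUpper p₁) (hp₂ : IsBlockUpper p₂) (g : GL (ι ⊕ ι) K) :
    ((p₁ * g * p₂ : GL (ι ⊕ ι) K) : Matrix (ι ⊕ ι) (ι ⊕ ι) K).toBlocks₂₁.rank =
      (g : Matrix (ι ⊕ ι) (ι ⊕ ι) K).toBlocks₂₁.rank := by
  have h1 : (p₁ : Matrix (ι ⊕ ι) (ι ⊕ ι) K).toBlocks₂₁ = 0 := hp₁
  have h2 : (p₂ : Matrix (ι ⊕ ι) (ι ⊕ ι) K).toBlocks₂₁ = 0 := hp₂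
  obtain ⟨-, hd₁⟩ := isUnit_det_diag_of_isBlockUpper hp₁
  obtain ⟨ha₂, -⟩ := isUnit_det_diag_of_isBlockUpper hp₂
  have hblk : ((p₁ * g * p₂ : GL (ι ⊕ ι) K) : Matrix (ι ⊕ ι) (ι ⊕ ι) K).toBlocks₂₁ =
      (p₁ : Matrix (ι ⊕ ι) (ι ⊕ ι) K).toBlocks₂₂ * (g : Matrix (ι ⊕ ι) (ι ⊕ ι) K).toBlocks₂₁ *
        (p₂ : Matrix (ι ⊕ ι) (ι ⊕ ι) K).toBlocks₁₁ := by
    rw [Units.val_mul, Units.val_mul]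
    conv_lhs => rw [← Matrix.fromBlocks_toBlocks (p₁ : Matrix (ι ⊕ ι) (ι ⊕ ι) K),
      ← Matrix.fromBlocks_toBlocks (g : Matrix (ι ⊕ ι) (ι ⊕ ι) K), ← Matrix.fromBlocks_toBlocks (p₂ : Matrix (ι ⊕ ι) (ι ⊕ ι) K)]
    rw [h1, h2, Matrix.fromBlocks_multiply, Matrix.fromBlocks_multiply, Matrix.toBlocks_fromBlocks₂₁]
    simp only [Matrix.zero_mul, zero_add, Matrix.mul_zero, add_zero]
  rw [hblk, Matrix.rank_mul_eq_left_of_isUnit_det _ _ ha₂, Matrix.rank_mul_eq_right_of_isUnit_det _ _ hd₁]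

end SplitModel

/-! ## §2 The row reduction -/

section Reduction

variable {σ}
variable (hσ : ∀ x, σ (σ x) = x)

/-- abbreviation: `U₁ = U(σ, antidiag(1,1))`. [folklore] -/
private abbrev U1 (σ : K →+* K) : Subgroup (GL (ι ⊕ ι) K) := unitaryGroupOfForm σ (antidiagForm (1 : Matrix ι ι K))

include hσ in
/-- **Step 1 (Levi normalisation of the lower-left block).** For `g ∈ U₁` there are Levi elements `L, R ∈ U₁` (block-diagonal)
and a `0∕1`-diagonal `e` with `(L g R)₂₁ = e` (pivot normal form of `g₂₁`). [folklore] -/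
private theorem step1 (g : GL (ι ⊕ ι) K) :
    ∃ (L R : GL (ι ⊕ ι) K) (χ : ι → K), (∀ i, χ i = 0 ∨ χ i = 1) ∧ L ∈ U1 σ ∧ R ∈ U1 σ ∧ IsBlockUpper L ∧ IsBlockUpper R ∧
      ((L * g * R : GL (ι ⊕ ι) K) : Matrix (ι ⊕ ι) (ι ⊕ ι) K).toBlocks₂₁ = Matrix.diagonal χ := by
  classical
  set c := (g : Matrix (ι ⊕ ι) (ι ⊕ ι) K).toBlocks₂₁ with hc
  obtain ⟨Lt, Lt', D, hD⟩ := Matrix.Pivot.exists_list_transvec_mul_mul_list_transvec_eq_diagonal c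
  set α := (Lt.map Matrix.TransvectionStruct.toMatrix).prod with hα
  set β := (Lt'.map Matrix.TransvectionStruct.toMatrix).prod with hβ
  have hαd : IsUnit α.det := by rw [hα, Matrix.TransvectionStruct.det_toMatrix_prod]; exact isUnit_one
  have hβd : IsUnit β.det := by rw [hβ, Matrix.TransvectionStruct.det_toMatrix_prod]; exact isUnit_one
  -- rescale the non-zero diagonal entries to `1`
  set r : Matrix ι ι K := Matrix.diagonal fun i => if D i = 0 then 1 else (D i)⁻¹ with hr
  have hrd : IsUnit r.det := by
    rw [hr, Matrix.det_diagonal]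
    refine IsUnit.mk0 _ (Finset.prod_ne_zero_iff.2 fun i _ => ?_)
    by_cases hi : D i = 0 <;> simp [hi]
  set χ : ι → K := fun i => if D i = 0 then 0 else 1 with hχ
  have hχ01 : ∀ i, χ i = 0 ∨ χ i = 1 := fun i => by by_cases hi : D i = 0 <;> simp [hχ, hi]
  have hre : r * Matrix.diagonal D = Matrix.diagonal χ := by
    rw [hr, Matrix.diagonal_mul_diagonal]
    congr 1; funext i
    by_cases hi : D i = 0 <;> simp [hχ, hi]
  set A := r * α with hA
  have hAd : IsUnit A.det := by rw [hA, Matrix.det_mul]; exact hrd.mul hαd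
  have hAcβ : A * c * β = Matrix.diagonal χ := by
    rw [hA, Matrix.mul_assoc r α, Matrix.mul_assoc r, hD, hre]
  refine ⟨leviLower σ A hAd, leviUpper σ β hβd, χ, hχ01, leviLower_mem σ hσ A hAd, leviUpper_mem σ hσ β hβd,
    isBlockUpper_blockDiagUnit, isBlockUpper_blockDiagUnit, ?_⟩
  rw [Units.val_mul, Units.val_mul, coe_leviLower, coe_leviUpper,
    ← Matrix.fromBlocks_toBlocks (g : Matrix (ι ⊕ ι) (ι ⊕ ι) K), Matrix.fromBlocks_multiply, Matrix.fromBlocks_multiply,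
    Matrix.toBlocks_fromBlocks₂₁]
  simp only [Matrix.zero_mul, zero_add, Matrix.mul_zero, add_zero]
  rw [← hc, hAcβ]

/-- the data carried through the reduction: `g ∈ U₁` with blocks `(a, b; e, d)`, `e` a `0∕1`-diagonal. [folklore] -/
private structure Reduced (σ : K →+* K) (χ : ι → K) (g : GL (ι ⊕ ι) K) : Prop where
  mem : g ∈ U1 σ
  block₂₁ : (g : Matrix (ι ⊕ ι) (ι ⊕ ι) K).toBlocks₂₁ = Matrix.diagonal χ

include hσ in
/-- **Step 2.** If `g₂₁ = e` then `n(x) g`, `x = −a e + e a* f`, has `g₂₁ = e` and `g₁₁ e = 0`. [folklore] -/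
private theorem step2 {χ : ι → K} (hχ : ∀ i, χ i = 0 ∨ χ i = 1) {g : GL (ι ⊕ ι) K} (hg : Reduced σ χ g) :
    ∃ p : GL (ι ⊕ ι) K, p ∈ U1 σ ∧ IsBlockUpper p ∧ Reduced σ χ (p * g) ∧
      ((p * g : GL (ι ⊕ ι) K) : Matrix (ι ⊕ ι) (ι ⊕ ι) K).toBlocks₁₁ * Matrix.diagonal χ = 0 := by
  obtain ⟨⟨h11, -, -, -⟩, -⟩ := blocks_rel_one σ hg.mem
  set e := Matrix.diagonal χ with he
  set f : Matrix ι ι K := 1 - e with hf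
  set M := (g : Matrix (ι ⊕ ι) (ι ⊕ ι) K) with hM
  set a := M.toBlocks₁₁
  set b := M.toBlocks₁₂
  set d := M.toBlocks₂₂
  have hc : M.toBlocks₂₁ = e := hg.block₂₁
  have hMblk : M = Matrix.fromBlocks a b e d := by rw [← hc]; exact (Matrix.fromBlocks_toBlocks M).symm
  have hee : e * e = e := diagonal01_mul_self χ hχ
  have hes : (e.map σ)ᵀ = e := star_diagonal01 σ χ hχ
  have hfe : f * e = 0 := compl_mul_self hee
  have hef : e * f = 0 := self_mul_compl hee
  have hepf : e + f = 1 := by rw [hf, add_sub_cancel]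
  have hfs : (f.map σ)ᵀ = f := by rw [hf, star_sub', hes, star_one']
  -- relation `e a + a* e = 0` and its consequences
  rw [hc, hes] at h11
  have h11' : e * a + (a.map σ)ᵀ * e = 0 := h11
  have hase : (a.map σ)ᵀ * e = -(e * a) := eq_neg_of_add_eq_zero_right h11'
  have heaf : e * (a * f) = 0 := by
    have := congrArg (· * f) h11'
    simpa only [Matrix.add_mul, Matrix.mul_assoc, hef, Matrix.mul_zero, add_zero, Matrix.zero_mul] using this
  have hea : e * a = e * (a * e) := by
    have : e * a = e * (a * e) + e * (a * f) := by rw [← Matrix.mul_add, ← Matrix.mul_add, hepf, Matrix.mul_one]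
    rw [this, heaf, add_zero]
  -- the skew `x`
  set x := -(a * e) + e * ((a.map σ)ᵀ * f) with hx
  have hxs : (x.map σ)ᵀ = -(e * (a.map σ)ᵀ) + f * (a * e) := by
    simp only [hx, star_add', star_neg', star_mul', hes, hfs, star_star' σ hσ, Matrix.mul_assoc]
  have hxskew : x + (x.map σ)ᵀ = 0 := by
    have F1 : a * e = e * (a * e) + f * (a * e) := by rw [← Matrix.add_mul, hepf, Matrix.one_mul]
    have F4 : e * (a.map σ)ᵀ = e * ((a.map σ)ᵀ * e) + e * ((a.map σ)ᵀ * f) := by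
      rw [← Matrix.mul_add, ← Matrix.mul_add, hepf, Matrix.mul_one]
    have F5 : e * ((a.map σ)ᵀ * e) = -(e * (a * e)) := by
      rw [hase, Matrix.mul_neg, ← Matrix.mul_assoc e e a, hee, hea]
    have B1 : -(a * e) + f * (a * e) = -(e * (a * e)) := by
      calc -(a * e) + f * (a * e) = -(e * (a * e) + f * (a * e)) + f * (a * e) := by rw [← F1]
        _ = -(e * (a * e)) := by abel
    have B2 : e * ((a.map σ)ᵀ * f) + -(e * (a.map σ)ᵀ) = -(e * ((a.map σ)ᵀ * e)) := by
      calc e * ((a.map σ)ᵀ * f) + -(e * (a.map σ)ᵀ)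
          = e * ((a.map σ)ᵀ * f) + -(e * ((a.map σ)ᵀ * e) + e * ((a.map σ)ᵀ * f)) := by rw [← F4]
        _ = -(e * ((a.map σ)ᵀ * e)) := by abel
    rw [hxs, hx]
    calc -(a * e) + e * ((a.map σ)ᵀ * f) + (-(e * (a.map σ)ᵀ) + f * (a * e))
        = (-(a * e) + f * (a * e)) + (e * ((a.map σ)ᵀ * f) + -(e * (a.map σ)ᵀ)) := by abel
      _ = -(e * (a * e)) + -(e * ((a.map σ)ᵀ * e)) := by rw [B1, B2]
      _ = 0 := by rw [F5]; abel
  have hpU : upperUnipotent x ∈ U1 σ := upperUnipotent_mem_one σ hxskew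
  have hxe : x * e = -(a * e) := by
    rw [hx, Matrix.add_mul, Matrix.neg_mul, Matrix.mul_assoc a e e, hee, Matrix.mul_assoc, Matrix.mul_assoc, hfe,
      Matrix.mul_zero, Matrix.mul_zero, add_zero]
  have hprod : ((upperUnipotent x * g : GL (ι ⊕ ι) K) : Matrix (ι ⊕ ι) (ι ⊕ ι) K) =
      Matrix.fromBlocks (a + x * e) (b + x * d) e d := by
    rw [Units.val_mul, ← hM, hMblk]
    show Matrix.fromBlocks 1 x 0 1 * Matrix.fromBlocks a b e d = _
    rw [Matrix.fromBlocks_multiply]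
    simp only [Matrix.one_mul, Matrix.zero_mul, zero_add]
  refine ⟨upperUnipotent x, hpU, isBlockUpper_upperUnipotent' x, ⟨(U1 σ).mul_mem hpU hg.mem, ?_⟩, ?_⟩
  · rw [hprod, Matrix.toBlocks_fromBlocks₂₁]
  · rw [hprod, Matrix.toBlocks_fromBlocks₁₁, hxe, Matrix.add_mul, Matrix.neg_mul, Matrix.mul_assoc, hee, add_neg_cancel]

include hσ in
/-- **Step 3.** If `g₂₁ = e` and `g₁₁ e = 0` then `g n(y)`, `y = −e d + f d* e`, keeps these and has `e g₂₂ = 0`. [folklore] -/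
private theorem step3 {χ : ι → K} (hχ : ∀ i, χ i = 0 ∨ χ i = 1) {g : GL (ι ⊕ ι) K} (hg : Reduced σ χ g)
    (hae : (g : Matrix (ι ⊕ ι) (ι ⊕ ι) K).toBlocks₁₁ * Matrix.diagonal χ = 0) :
    ∃ p : GL (ι ⊕ ι) K, p ∈ U1 σ ∧ IsBlockUpper p ∧ Reduced σ χ (g * p) ∧
      ((g * p : GL (ι ⊕ ι) K) : Matrix (ι ⊕ ι) (ι ⊕ ι) K).toBlocks₁₁ * Matrix.diagonal χ = 0 ∧
      Matrix.diagonal χ * ((g * p : GL (ι ⊕ ι) K) : Matrix (ι ⊕ ι) (ι ⊕ ι) K).toBlocks₂₂ = 0 := by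
  obtain ⟨-, ⟨-, -, s21, -⟩⟩ := blocks_rel_one σ hg.mem
  set e := Matrix.diagonal χ with he
  set f : Matrix ι ι K := 1 - e with hf
  set M := (g : Matrix (ι ⊕ ι) (ι ⊕ ι) K) with hM
  set a := M.toBlocks₁₁
  set b := M.toBlocks₁₂
  set d := M.toBlocks₂₂
  have hc : M.toBlocks₂₁ = e := hg.block₂₁
  have hMblk : M = Matrix.fromBlocks a b e d := by rw [← hc]; exact (Matrix.fromBlocks_toBlocks M).symm
  have hee : e * e = e := diagonal01_mul_self χ hχ
  have hes : (e.map σ)ᵀ = e := star_diagonal01 σ χ hχ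
  have hfe : f * e = 0 := compl_mul_self hee
  have hef : e * f = 0 := self_mul_compl hee
  have hepf : e + f = 1 := by rw [hf, add_sub_cancel]
  have hfs : (f.map σ)ᵀ = f := by rw [hf, star_sub', hes, star_one']
  -- relation `e d* + d e = 0` and its consequences
  rw [hc, hes] at s21
  have s21' : e * (d.map σ)ᵀ + d * e = 0 := s21
  have heds : e * (d.map σ)ᵀ = -(d * e) := eq_neg_of_add_eq_zero_left s21'
  have hfde : f * (d * e) = 0 := by
    have := congrArg (f * ·) s21'
    simpa only [Matrix.mul_add, ← Matrix.mul_assoc, hfe, Matrix.zero_mul, zero_add, Matrix.mul_zero] using this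
  have hde : d * e = e * (d * e) := by
    have : d * e = e * (d * e) + f * (d * e) := by rw [← Matrix.add_mul, hepf, Matrix.one_mul]
    conv_lhs => rw [this]
    rw [hfde, add_zero]
  -- the skew `y`
  set y := -(e * d) + f * ((d.map σ)ᵀ * e) with hy
  have hys : (y.map σ)ᵀ = -((d.map σ)ᵀ * e) + e * (d * f) := by
    simp only [hy, star_add', star_neg', star_mul', hes, hfs, star_star' σ hσ, Matrix.mul_assoc]
  have hyskew : y + (y.map σ)ᵀ = 0 := by
    have G1 : e * d = e * (d * e) + e * (d * f) := by rw [← Matrix.mul_add, ← Matrix.mul_add, hepf, Matrix.mul_one]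
    have G2 : (d.map σ)ᵀ * e = e * ((d.map σ)ᵀ * e) + f * ((d.map σ)ᵀ * e) := by rw [← Matrix.add_mul, hepf, Matrix.one_mul]
    have G3 : e * ((d.map σ)ᵀ * e) = -(e * (d * e)) := by
      rw [← Matrix.mul_assoc, heds, Matrix.neg_mul, Matrix.mul_assoc, hee, ← hde]
    have B1 : -(e * d) + e * (d * f) = -(e * (d * e)) := by
      calc -(e * d) + e * (d * f) = -(e * (d * e) + e * (d * f)) + e * (d * f) := by rw [← G1]
        _ = -(e * (d * e)) := by abel
    have B2 : f * ((d.map σ)ᵀ * e) + -((d.map σ)ᵀ * e) = -(e * ((d.map σ)ᵀ * e)) := by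
      calc f * ((d.map σ)ᵀ * e) + -((d.map σ)ᵀ * e)
          = f * ((d.map σ)ᵀ * e) + -(e * ((d.map σ)ᵀ * e) + f * ((d.map σ)ᵀ * e)) := by rw [← G2]
        _ = -(e * ((d.map σ)ᵀ * e)) := by abel
    rw [hys, hy]
    calc -(e * d) + f * ((d.map σ)ᵀ * e) + (-((d.map σ)ᵀ * e) + e * (d * f))
        = (-(e * d) + e * (d * f)) + (f * ((d.map σ)ᵀ * e) + -((d.map σ)ᵀ * e)) := by abel
      _ = -(e * (d * e)) + -(e * ((d.map σ)ᵀ * e)) := by rw [B1, B2]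
      _ = 0 := by rw [G3]; abel
  have hpU : upperUnipotent y ∈ U1 σ := upperUnipotent_mem_one σ hyskew
  have hey : e * y = -(e * d) := by
    rw [hy, Matrix.mul_add, Matrix.mul_neg, ← Matrix.mul_assoc e e d, hee, ← Matrix.mul_assoc e f, hef, Matrix.zero_mul,
      add_zero]
  have hprod : ((g * upperUnipotent y : GL (ι ⊕ ι) K) : Matrix (ι ⊕ ι) (ι ⊕ ι) K) =
      Matrix.fromBlocks a (a * y + b) e (e * y + d) := by
    rw [Units.val_mul, ← hM, hMblk]
    show Matrix.fromBlocks a b e d * Matrix.fromBlocks 1 y 0 1 = _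
    rw [Matrix.fromBlocks_multiply]
    simp only [Matrix.mul_one, Matrix.mul_zero, add_zero]
  refine ⟨upperUnipotent y, hpU, isBlockUpper_upperUnipotent' y, ⟨(U1 σ).mul_mem hg.mem hpU, ?_⟩, ?_, ?_⟩
  · rw [hprod, Matrix.toBlocks_fromBlocks₂₁]
  · rw [hprod, Matrix.toBlocks_fromBlocks₁₁]; exact hae
  · rw [hprod, Matrix.toBlocks_fromBlocks₂₂, Matrix.mul_add, ← Matrix.mul_assoc, hee, hey, neg_add_cancel]

include hσ in
/-- **Steps 4–5.** If `g₂₁ = e`, `g₁₁ e = 0`, `e g₂₂ = 0` then `g = m · w_E · n` with `m` a Levi element and `n` unipotent, both in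
`P ∩ U₁`: the relations give `e a = 0 = d e`, `d* a = a* d = a d* = d a* = f`, the Levi element `diag(e + d*, e + a*)` (inverse
`diag(e + a, e + d)`) carries `g` to `[[f, b'], [e, f]] = w_E · n(f b')`. [folklore] -/
private theorem step45 {χ : ι → K} (hχ : ∀ i, χ i = 0 ∨ χ i = 1) {g : GL (ι ⊕ ι) K} (hg : Reduced σ χ g)
    (hae : (g : Matrix (ι ⊕ ι) (ι ⊕ ι) K).toBlocks₁₁ * Matrix.diagonal χ = 0)
    (hed : Matrix.diagonal χ * (g : Matrix (ι ⊕ ι) (ι ⊕ ι) K).toBlocks₂₂ = 0) :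
    ∃ m q : GL (ι ⊕ ι) K, m ∈ U1 σ ∧ q ∈ U1 σ ∧ IsBlockUpper m ∧ IsBlockUpper q ∧
      m * g = partialWeyl (Matrix.diagonal χ) (diagonal01_mul_self χ hχ) * q := by
  obtain ⟨⟨h11, h12, h21, -⟩, ⟨s11, -, s21, -⟩⟩ := blocks_rel_one σ hg.mem
  set e := Matrix.diagonal χ with he
  set f : Matrix ι ι K := 1 - e with hf
  set M := (g : Matrix (ι ⊕ ι) (ι ⊕ ι) K) with hM
  set a := M.toBlocks₁₁
  set b := M.toBlocks₁₂
  set d := M.toBlocks₂₂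
  have hc : M.toBlocks₂₁ = e := hg.block₂₁
  have hMblk : M = Matrix.fromBlocks a b e d := by rw [← hc]; exact (Matrix.fromBlocks_toBlocks M).symm
  have hee : e * e = e := diagonal01_mul_self χ hχ
  have hes : (e.map σ)ᵀ = e := star_diagonal01 σ χ hχ
  have hef : e * f = 0 := self_mul_compl hee
  have hfe : f * e = 0 := compl_mul_self hee
  have hff : f * f = f := compl_mul_compl hee
  have hepf : e + f = 1 := by rw [hf, add_sub_cancel]
  have hfs : (f.map σ)ᵀ = f := by rw [hf, star_sub', hes, star_one']
  rw [hc] at h11 h12 h21 s11 s21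
  rw [hes] at h11 h12 s11 s21
  -- (i) `e a = 0`, `d e = 0`, hence `a e = 0`, `e d = 0` are all four available
  have heaf : e * a * f = 0 := by
    have := congrArg (· * f) h11
    simpa only [Matrix.add_mul, Matrix.mul_assoc, hef, Matrix.mul_zero, add_zero, Matrix.zero_mul] using this
  have hea : e * a = 0 := by
    have : e * a = e * a * e + e * a * f := by rw [← Matrix.mul_add, hepf, Matrix.mul_one]
    rw [this, heaf, add_zero, Matrix.mul_assoc, hae, Matrix.mul_zero]
  have hfde : f * d * e = 0 := by
    have := congrArg (f * ·) s21
    simpa only [Matrix.mul_add, ← Matrix.mul_assoc, hfe, Matrix.zero_mul, zero_add, Matrix.mul_zero] using this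
  have hde : d * e = 0 := by
    have : d * e = e * d * e + f * d * e := by rw [← Matrix.add_mul, ← Matrix.add_mul, hepf, Matrix.one_mul]
    rw [this, hfde, add_zero, Matrix.mul_assoc, ← Matrix.mul_assoc e d e, hed, Matrix.zero_mul]
  have haes : e * (a.map σ)ᵀ = 0 := by rw [← hes, ← star_mul' σ, hae, star_zero']
  have hase : (a.map σ)ᵀ * e = 0 := by rw [← hes, ← star_mul' σ, hea, star_zero']
  have hdes : (d.map σ)ᵀ * e = 0 := by rw [← hes, ← star_mul' σ, hed, star_zero']
  have heds : e * (d.map σ)ᵀ = 0 := by rw [← hes, ← star_mul' σ, hde, star_zero']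
  -- (ii) `a = a f`, `d = f d` and the four products
  have haf : a * f = a := by rw [hf, Matrix.mul_sub, Matrix.mul_one, hae, sub_zero]
  have hfd : f * d = d := by rw [hf, Matrix.sub_mul, Matrix.one_mul, hed, sub_zero]
  have hdsa : (d.map σ)ᵀ * a = f := by
    -- `d* a + b* e = 1`, times `f` on the right: `d* a f = f`
    have := congrArg (· * f) h21
    simp only [Matrix.add_mul, Matrix.mul_assoc, hef, Matrix.mul_zero, add_zero, Matrix.one_mul] at this
    rwa [haf] at this
  have hasd : (a.map σ)ᵀ * d = f := by
    -- `e b + a* d = 1`, times `f` on the left: `f a* d = f`; and `a* d = f a* d` since `e a* = 0`… use `a* = (e+f) a*`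
    have := congrArg (f * ·) h12
    simp only [Matrix.mul_add, ← Matrix.mul_assoc, hfe, Matrix.zero_mul, zero_add, Matrix.mul_one] at this
    have h' : (a.map σ)ᵀ * d = f * (a.map σ)ᵀ * d := by
      conv_lhs => rw [← Matrix.one_mul ((a.map σ)ᵀ), ← hepf, Matrix.add_mul, haes, zero_add]
    rw [h', this]
  have hads : a * (d.map σ)ᵀ = f := by
    -- `a d* + b e = 1`; `a = a f`… multiply by `f` on both sides
    have := congrArg (fun z => f * z * f) s11
    simp only [Matrix.mul_add, Matrix.add_mul, Matrix.mul_assoc, hef, Matrix.mul_zero, add_zero, Matrix.mul_one] at this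
    -- `this : f * (a * (d* * f)) = f * f`
    have h1 : a = f * a := by rw [hf, Matrix.sub_mul, Matrix.one_mul, hea, sub_zero]
    have h2 : (d.map σ)ᵀ = (d.map σ)ᵀ * f := by rw [hf, Matrix.mul_sub, Matrix.mul_one, hdes, sub_zero]
    rw [h1, h2, Matrix.mul_assoc, this, hff]
  have hdas : d * (a.map σ)ᵀ = f := by
    rw [← star_star' σ hσ d, ← star_mul' σ, hads, hfs]
  -- (iii) the Levi element `diag(e + d*, e + a*)` with inverse `diag(e + a, e + d)`
  have I1 : (e + (d.map σ)ᵀ) * (e + a) = 1 := by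
    rw [Matrix.add_mul, Matrix.mul_add, Matrix.mul_add, hee, hea, hdsa, hdes, add_zero, zero_add, hepf]
  have I2 : (e + a) * (e + (d.map σ)ᵀ) = 1 := mul_eq_one_comm.1 I1
  have I3 : (e + (a.map σ)ᵀ) * (e + d) = 1 := by
    rw [Matrix.add_mul, Matrix.mul_add, Matrix.mul_add, hee, hed, hase, hasd, add_zero, zero_add, hepf]
  have I4 : (e + d) * (e + (a.map σ)ᵀ) = 1 := mul_eq_one_comm.1 I3
  let m : GL (ι ⊕ ι) K := blockDiagUnit (e + (d.map σ)ᵀ) (e + (a.map σ)ᵀ) (e + a) (e + d) I1 I3 I2 I4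
  have hmU : m ∈ U1 σ := by
    refine blockDiagUnit_mem σ ?_ ?_
    · rw [star_add', hes, star_star' σ hσ]; exact I4
    · rw [star_add', hes, star_star' σ hσ]; exact I2
  -- (iv) `m g = [[f, b'], [e, f]]`, `b' = (e + d*) b`
  set b' := (e + (d.map σ)ᵀ) * b with hb'
  have hmg : ((m * g : GL (ι ⊕ ι) K) : Matrix (ι ⊕ ι) (ι ⊕ ι) K) = Matrix.fromBlocks f b' e f := by
    rw [Units.val_mul, coe_blockDiagUnit, ← hM, hMblk, Matrix.fromBlocks_multiply]
    simp only [Matrix.zero_mul, add_zero, zero_add]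
    rw [Matrix.add_mul e ((d.map σ)ᵀ) a, hea, hdsa, zero_add, Matrix.add_mul e ((a.map σ)ᵀ) e, hee, hase, add_zero,
      Matrix.add_mul e ((a.map σ)ᵀ) d, hed, hasd, zero_add]
  -- (v) relations for `m g`: `e b' = e`, `f b' + b'* f = 0`
  have hmgU : m * g ∈ U1 σ := (U1 σ).mul_mem hmU hg.mem
  obtain ⟨⟨-, -, r21₀, r22₀⟩, -⟩ := blocks_rel_one σ hmgU
  have r21 : f + (b'.map σ)ᵀ * e = 1 := by
    simpa only [hmg, Matrix.toBlocks_fromBlocks₁₁, Matrix.toBlocks_fromBlocks₁₂, Matrix.toBlocks_fromBlocks₂₁,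
      Matrix.toBlocks_fromBlocks₂₂, hfs, hff] using r21₀
  have r22 : f * b' + (b'.map σ)ᵀ * f = 0 := by
    simpa only [hmg, Matrix.toBlocks_fromBlocks₁₁, Matrix.toBlocks_fromBlocks₁₂, Matrix.toBlocks_fromBlocks₂₁,
      Matrix.toBlocks_fromBlocks₂₂, hfs] using r22₀
  -- `r21 : f + b'* e = 1` ⇒ `b'* e = e` ⇒ `e b' = e`
  have hbse : (b'.map σ)ᵀ * e = e := by
    have := congrArg (fun z => z - f) r21
    simpa only [add_sub_cancel_left, ← hepf, add_sub_cancel_right] using this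
  have heb : e * b' = e := by
    have := congrArg (fun z => (z.map σ)ᵀ) hbse
    simpa only [star_mul' σ, hes, star_star' σ hσ] using this
  -- (vi) `z = f b'` is skew and `m g = w_E n(z)`
  set z := f * b' with hz
  have hzskew : z + (z.map σ)ᵀ = 0 := by rw [hz, star_mul' σ, hfs]; exact r22
  have hzU : upperUnipotent z ∈ U1 σ := upperUnipotent_mem_one σ hzskew
  have hfz : f * z = f * b' := by rw [hz, ← Matrix.mul_assoc, hff]
  have hez : e * z = 0 := by rw [hz, ← Matrix.mul_assoc, hef, Matrix.zero_mul]
  have hwz : ((partialWeyl e hee * upperUnipotent z : GL (ι ⊕ ι) K) : Matrix (ι ⊕ ι) (ι ⊕ ι) K) = Matrix.fromBlocks f b' e f := by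
    rw [Units.val_mul, coe_partialWeyl]
    show Matrix.fromBlocks (1 - e) e e (1 - e) * Matrix.fromBlocks 1 z 0 1 = _
    rw [Matrix.fromBlocks_multiply, ← hf]
    simp only [Matrix.mul_one, Matrix.mul_zero, add_zero, hfz, hez, zero_add]
    congr 1
    -- `f b' + e = b'` since `e b' = e`
    calc f * b' + e = f * b' + e * b' := by rw [heb]
      _ = b' := by rw [← Matrix.add_mul, add_comm, hepf, Matrix.one_mul]
  refine ⟨m, upperUnipotent z, hmU, hzU, isBlockUpper_blockDiagUnit, isBlockUpper_upperUnipotent' z, Units.ext ?_⟩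
  rw [hmg, hwz]

include hσ in
/-- **Bruhat decomposition of `U(σ, antidiag(1,1))` relative to the Siegel parabolic** (split model): every `g` is
`p₁ · w_E · p₂` with `p₁, p₂ ∈ P ∩ U₁` and `E` a `0∕1`-diagonal matrix. [cite: Kudla1994, §3; HarrisKudlaSweet1996, §1 (1.12)] -/
theorem exists_bruhat_antidiag_one {g : GL (ι ⊕ ι) K} (hg : g ∈ unitaryGroupOfForm σ (antidiagForm (1 : Matrix ι ι K))) :
    ∃ (χ : ι → K) (hχ : ∀ i, χ i = 0 ∨ χ i = 1) (p₁ p₂ : GL (ι ⊕ ι) K),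
      p₁ ∈ unitaryGroupOfForm σ (antidiagForm (1 : Matrix ι ι K)) ∧ p₂ ∈ unitaryGroupOfForm σ (antidiagForm (1 : Matrix ι ι K)) ∧
      IsBlockUpper p₁ ∧ IsBlockUpper p₂ ∧
      g = p₁ * partialWeyl (Matrix.diagonal χ) (diagonal01_mul_self χ hχ) * p₂ := by
  obtain ⟨L, R, χ, hχ, hL, hR, hLu, hRu, hc⟩ := step1 hσ g
  have hg1 : Reduced σ χ (L * g * R) := ⟨(U1 σ).mul_mem ((U1 σ).mul_mem hL hg) hR, hc⟩
  obtain ⟨n₁, hn₁, hn₁u, hg2, hae⟩ := step2 hσ hχ hg1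
  obtain ⟨n₂, hn₂, hn₂u, hg3, hae3, hed3⟩ := step3 hσ hχ hg2 hae
  obtain ⟨m, q, hm, hq, hmu, hqu, hfac⟩ := step45 hσ hχ hg3 hae3 hed3
  -- `m (n₁ (L g R) n₂) = w q` ⇒ `g = (L⁻¹ n₁⁻¹ m⁻¹) w (q n₂⁻¹ R⁻¹)`
  refine ⟨χ, hχ, L⁻¹ * n₁⁻¹ * m⁻¹, q * n₂⁻¹ * R⁻¹,
    (U1 σ).mul_mem ((U1 σ).mul_mem ((U1 σ).inv_mem hL) ((U1 σ).inv_mem hn₁)) ((U1 σ).inv_mem hm),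
    (U1 σ).mul_mem ((U1 σ).mul_mem hq ((U1 σ).inv_mem hn₂)) ((U1 σ).inv_mem hR),
    isBlockUpper_mul (isBlockUpper_mul (isBlockUpper_inv hLu) (isBlockUpper_inv hn₁u)) (isBlockUpper_inv hmu),
    isBlockUpper_mul (isBlockUpper_mul hqu (isBlockUpper_inv hn₂u)) (isBlockUpper_inv hRu), ?_⟩
  have h : m * (n₁ * (L * g * R) * n₂) = partialWeyl (Matrix.diagonal χ) (diagonal01_mul_self χ hχ) * q := hfac
  calc g = L⁻¹ * n₁⁻¹ * m⁻¹ * (m * (n₁ * (L * g * R) * n₂)) * (n₂⁻¹ * R⁻¹) := by group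
    _ = L⁻¹ * n₁⁻¹ * m⁻¹ * partialWeyl (Matrix.diagonal χ) (diagonal01_mul_self χ hχ) * (q * n₂⁻¹ * R⁻¹) := by
      rw [h]; group

/-- **Kudla's index**: in the decomposition `g = p₁ w_E p₂` the rank of `E` (= the number of its unit entries) is the rank of
the lower-left block `g₂₁`; in particular it does not depend on the decomposition. [cite: Kudla1994, §3] -/
theorem rank_block₂₁_eq_of_bruhat {g p₁ p₂ : GL (ι ⊕ ι) K} {χ : ι → K} (hχ : ∀ i, χ i = 0 ∨ χ i = 1)
    (hp₁ : IsBlockUpper p₁) (hp₂ : IsBlockUpper p₂)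
    (h : g = p₁ * partialWeyl (Matrix.diagonal χ) (diagonal01_mul_self χ hχ) * p₂) :
    (g : Matrix (ι ⊕ ι) (ι ⊕ ι) K).toBlocks₂₁.rank = (Matrix.diagonal χ).rank := by
  rw [h, rank_block₂₁_mul_mul hp₁ hp₂, partialWeyl_block₂₁]

end Reduction

/-! ## §3 Transport to the models `antidiag(τ, τ)` -/

section Transport

variable {τ : Matrix ι ι K}

variable (τ) in
/-- the rescaling `R = diag(1, τ⁻¹)` carrying `antidiag(τ, τ)` to the split model `antidiag(1, 1)`. [folklore] -/
def rescale (hτu : IsUnit τ.det) : GL (ι ⊕ ι) K :=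
  blockDiagUnit 1 τ⁻¹ 1 τ (Matrix.mul_one 1) (Matrix.nonsing_inv_mul τ hτu) (Matrix.mul_one 1) (Matrix.mul_nonsing_inv τ hτu)

/-- underlying matrix of `R`. [folklore] -/
@[simp] private theorem coe_rescale (hτu : IsUnit τ.det) :
    ((rescale τ hτu : GL (ι ⊕ ι) K) : Matrix (ι ⊕ ι) (ι ⊕ ι) K) = Matrix.fromBlocks 1 0 0 τ⁻¹ := rfl

/-- underlying matrix of `R⁻¹`. [folklore] -/
@[simp] private theorem coe_rescale_inv (hτu : IsUnit τ.det) :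
    (((rescale τ hτu)⁻¹ : GL (ι ⊕ ι) K) : Matrix (ι ⊕ ι) (ι ⊕ ι) K) = Matrix.fromBlocks 1 0 0 τ := rfl

/-- **`σ(R)ᵀ · antidiag(τ, τ) · R = antidiag(1, 1)`** for `τ` symmetric, `σ`-fixed, invertible: the doubled space is the
split (hyperbolic) hermitian space. [cite: HarrisKudlaSweet1996, §1 (1.11)] -/
theorem formCongr_rescale_antidiag (hτ : τ.map σ = τ) (hτs : τᵀ = τ) (hτu : IsUnit τ.det) :
    formCongr σ (rescale τ hτu) (antidiagForm τ) = antidiagForm (1 : Matrix ι ι K) := by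
  have hτi : ((τ⁻¹).map σ)ᵀ = τ⁻¹ := by
    rw [star_inv' σ hτu, hτ, hτs]
  rw [formCongr, coe_rescale, Matrix.fromBlocks_map, Matrix.fromBlocks_transpose, star_one', star_zero', hτi]
  show _ * Matrix.fromBlocks 0 τ τ 0 * _ = Matrix.fromBlocks 0 1 1 0
  simp only [Matrix.fromBlocks_multiply, Matrix.mul_zero, Matrix.zero_mul, Matrix.one_mul, Matrix.mul_one, zero_add,
    add_zero, Matrix.mul_nonsing_inv τ hτu, Matrix.nonsing_inv_mul τ hτu]

/-- **Bruhat decomposition of `U(σ, antidiag(τ, τ))` relative to its Siegel parabolic**: every `g` is `p₁ · w · p₂` with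
`p₁, p₂` block-upper elements of the group and `w = R · w_E · R⁻¹` the rescaled partial Weyl element of a `0∕1`-diagonal `E`
(lower-left block `τ⁻¹ E`, of rank `rank E = rank g₂₁`). [cite: Kudla1994, §3; HarrisKudlaSweet1996, §1 (1.12)] -/
theorem exists_bruhat_antidiag (hσ : ∀ x, σ (σ x) = x) (hτ : τ.map σ = τ) (hτs : τᵀ = τ) (hτu : IsUnit τ.det)
    {g : GL (ι ⊕ ι) K} (hg : g ∈ unitaryGroupOfForm σ (antidiagForm τ)) :
    ∃ (χ : ι → K) (hχ : ∀ i, χ i = 0 ∨ χ i = 1) (p₁ p₂ : GL (ι ⊕ ι) K),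
      p₁ ∈ unitaryGroupOfForm σ (antidiagForm τ) ∧ p₂ ∈ unitaryGroupOfForm σ (antidiagForm τ) ∧
      IsBlockUpper p₁ ∧ IsBlockUpper p₂ ∧
      g = p₁ * (rescale τ hτu * partialWeyl (Matrix.diagonal χ) (diagonal01_mul_self χ hχ) * (rescale τ hτu)⁻¹) * p₂ := by
  set R : GL (ι ⊕ ι) K := rescale τ hτu with hR
  have hform := formCongr_rescale_antidiag σ hτ hτs hτu
  -- `g' := R⁻¹ g R` lies in the split model
  have hg' : R⁻¹ * g * R ∈ unitaryGroupOfForm σ (antidiagForm (1 : Matrix ι ι K)) := by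
    rw [← hform, ← conj_mem_unitaryGroupOfForm_iff]
    have : R * (R⁻¹ * g * R) * R⁻¹ = g := by group
    rw [this]; exact hg
  obtain ⟨χ, hχ, q₁, q₂, hq₁, hq₂, hq₁u, hq₂u, hfac⟩ := exists_bruhat_antidiag_one hσ hg'
  have hconj : ∀ q ∈ unitaryGroupOfForm σ (antidiagForm (1 : Matrix ι ι K)), R * q * R⁻¹ ∈ unitaryGroupOfForm σ (antidiagForm τ) := by
    intro q hq
    rw [conj_mem_unitaryGroupOfForm_iff, hR, hform]; exact hq
  have hRu : IsBlockUpper R := by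
    show ((rescale τ hτu : GL (ι ⊕ ι) K) : Matrix (ι ⊕ ι) (ι ⊕ ι) K).toBlocks₂₁ = 0
    rw [coe_rescale, Matrix.toBlocks_fromBlocks₂₁]
  have hRiu : IsBlockUpper R⁻¹ := by
    show (((rescale τ hτu)⁻¹ : GL (ι ⊕ ι) K) : Matrix (ι ⊕ ι) (ι ⊕ ι) K).toBlocks₂₁ = 0
    rw [coe_rescale_inv, Matrix.toBlocks_fromBlocks₂₁]
  refine ⟨χ, hχ, R * q₁ * R⁻¹, R * q₂ * R⁻¹, hconj q₁ hq₁, hconj q₂ hq₂,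
    isBlockUpper_mul (isBlockUpper_mul hRu hq₁u) hRiu, isBlockUpper_mul (isBlockUpper_mul hRu hq₂u) hRiu, ?_⟩
  calc g = R * (R⁻¹ * g * R) * R⁻¹ := by group
    _ = R * (q₁ * partialWeyl (Matrix.diagonal χ) (diagonal01_mul_self χ hχ) * q₂) * R⁻¹ := by rw [hfac]
    _ = R * q₁ * R⁻¹ * (R * partialWeyl (Matrix.diagonal χ) (diagonal01_mul_self χ hχ) * R⁻¹) * (R * q₂ * R⁻¹) := by group

end Transport

/-! ## §4 The diagonal model `S ⊕ (−S)` and its re-enumerations (`P_Δ`: `p₁₁ + p₁₂ = p₂₁ + p₂₂`) -/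

section DiagModel

/-- underlying matrix of the Cayley change of basis `C = [[1, 1], [1, −1]]` of `UnitaryGroupDoubledSiegelGeneration`
(`C (u, 0) = (u, u)`: the `Δ`-adapted coordinates of the doubled space). [cite: HarrisKudlaSweet1996, §1 (1.11)] -/
theorem coe_cayley (h2 : (2 : K) ≠ 0) :
    ((cayley K ι h2 : GL (ι ⊕ ι) K) : Matrix (ι ⊕ ι) (ι ⊕ ι) K) = Matrix.fromBlocks 1 1 1 (-1) := rfl

/-- **`σ(C)ᵀ (S ⊕ −S) C = antidiag(S + S, S + S)`**: in `Δ`-adapted coordinates the doubled hermitian space is split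
(public form of the transport used in `UnitaryGroupDoubledSiegelGeneration`). [cite: HarrisKudlaSweet1996, §1 (1.11)] -/
theorem formCongr_cayley_diagForm (h2 : (2 : K) ≠ 0) (S : Matrix ι ι K) :
    formCongr σ (cayley K ι h2) (diagForm S) = antidiagForm (S + S) := by
  have hneg : ((-1 : Matrix ι ι K).map σ)ᵀ = -1 := by rw [star_neg', star_one']
  have hC : ((Matrix.fromBlocks 1 1 1 (-1) : Matrix (ι ⊕ ι) (ι ⊕ ι) K).map σ)ᵀ = Matrix.fromBlocks 1 1 1 (-1) := by
    rw [Matrix.fromBlocks_map, Matrix.fromBlocks_transpose, star_one', hneg]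
  rw [formCongr, coe_cayley, hC]
  show _ * Matrix.fromBlocks S 0 0 (-S) * _ = Matrix.fromBlocks 0 (S + S) (S + S) 0
  simp only [Matrix.fromBlocks_multiply, Matrix.one_mul, Matrix.mul_one, Matrix.mul_zero, zero_add, add_zero,
    Matrix.neg_mul, Matrix.mul_neg, neg_neg, add_neg_cancel]

/-- **membership transport along `C`**: `C⁻¹ g C ∈ U(σ, antidiag(S+S, S+S)) ↔ g ∈ U(σ, S ⊕ −S)`. [cite: HarrisKudlaSweet1996, §1 (1.11)] -/
theorem cayley_inv_conj_mem_antidiag_iff (h2 : (2 : K) ≠ 0) (S : Matrix ι ι K) (g : GL (ι ⊕ ι) K) :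
    (cayley K ι h2)⁻¹ * g * cayley K ι h2 ∈ unitaryGroupOfForm σ (antidiagForm (S + S)) ↔
      g ∈ unitaryGroupOfForm σ (diagForm S) := by
  rw [← formCongr_cayley_diagForm σ h2 S, ← conj_mem_unitaryGroupOfForm_iff]
  have : cayley K ι h2 * ((cayley K ι h2)⁻¹ * g * cayley K ι h2) * (cayley K ι h2)⁻¹ = g := by group
  rw [this]

/-- **membership transport along `C`**, conjugation form: `C q C⁻¹ ∈ U(σ, S ⊕ −S) ↔ q ∈ U(σ, antidiag(S+S, S+S))`.
[cite: HarrisKudlaSweet1996, §1 (1.11)] -/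
theorem cayley_conj_mem_diag_iff (h2 : (2 : K) ≠ 0) (S : Matrix ι ι K) (q : GL (ι ⊕ ι) K) :
    cayley K ι h2 * q * (cayley K ι h2)⁻¹ ∈ unitaryGroupOfForm σ (diagForm S) ↔
      q ∈ unitaryGroupOfForm σ (antidiagForm (S + S)) := by
  rw [conj_mem_unitaryGroupOfForm_iff, formCongr_cayley_diagForm σ h2 S]

/-- `q ∈ P_Δ` iff the two left blocks of `q C` agree. [cite: HarrisKudlaSweet1996, §1 (1.11)] -/
theorem isSiegelSum_iff_mul_cayley (h2 : (2 : K) ≠ 0) (q : GL (ι ⊕ ι) K) :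
    IsSiegelSum q ↔
      ((q : Matrix (ι ⊕ ι) (ι ⊕ ι) K) * (cayley K ι h2 : GL (ι ⊕ ι) K)).toBlocks₁₁ =
        ((q : Matrix (ι ⊕ ι) (ι ⊕ ι) K) * (cayley K ι h2 : GL (ι ⊕ ι) K)).toBlocks₂₁ := by
  set M := (q : Matrix (ι ⊕ ι) (ι ⊕ ι) K)
  conv_rhs => rw [← Matrix.fromBlocks_toBlocks M, coe_cayley, Matrix.fromBlocks_multiply]
  simp only [Matrix.toBlocks_fromBlocks₁₁, Matrix.toBlocks_fromBlocks₂₁, Matrix.mul_one]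
  rfl

/-- a block-upper `p` of the anti-diagonal model becomes a `P_Δ`-element `C p C⁻¹` of the diagonal model.
[cite: HarrisKudlaSweet1996, §1 (1.11)] -/
theorem isSiegelSum_cayley_conj (h2 : (2 : K) ≠ 0) {p : GL (ι ⊕ ι) K} (hp : IsBlockUpper p) :
    IsSiegelSum (cayley K ι h2 * p * (cayley K ι h2)⁻¹) := by
  rw [isSiegelSum_iff_mul_cayley h2, Units.val_mul, Units.val_mul, Matrix.mul_assoc, Matrix.mul_assoc,
    ← Units.val_mul, inv_mul_cancel, Units.val_one, Matrix.mul_one, coe_cayley,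
    ← Matrix.fromBlocks_toBlocks (p : Matrix (ι ⊕ ι) (ι ⊕ ι) K), Matrix.fromBlocks_multiply]
  have hp' : (p : Matrix (ι ⊕ ι) (ι ⊕ ι) K).toBlocks₂₁ = 0 := hp
  simp [hp']

/-- **Bruhat decomposition of `U(σ, S ⊕ −S)` relative to `P_Δ = {p ∣ p₁₁ + p₁₂ = p₂₁ + p₂₂}`** (block enumeration `ι ⊕ ι`;
`2 ≠ 0`, `S` symmetric `σ`-fixed of unit determinant): every `g` is `p₁ · w · p₂` with `p₁, p₂ ∈ P_Δ ∩ U` and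
`w = C R w_E R⁻¹ C⁻¹` the transported partial Weyl element of a `0∕1`-diagonal `E` (`C` the Cayley change of basis,
`R = diag(1, (S+S)⁻¹)`). [cite: Kudla1994, §3; HarrisKudlaSweet1996, §1 (1.12)] -/
theorem exists_bruhat_diag (h2 : (2 : K) ≠ 0) (hσ : ∀ x, σ (σ x) = x) {S : Matrix ι ι K} (hSσ : S.map σ = S)
    (hSs : Sᵀ = S) (hSu : IsUnit S.det) {g : GL (ι ⊕ ι) K} (hg : g ∈ unitaryGroupOfForm σ (diagForm S)) :
    ∃ (χ : ι → K) (hχ : ∀ i, χ i = 0 ∨ χ i = 1) (hτu : IsUnit (S + S).det) (p₁ p₂ : GL (ι ⊕ ι) K),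
      p₁ ∈ unitaryGroupOfForm σ (diagForm S) ∧ p₂ ∈ unitaryGroupOfForm σ (diagForm S) ∧
      IsSiegelSum p₁ ∧ IsSiegelSum p₂ ∧
      g = p₁ * (cayley K ι h2 * (rescale (S + S) hτu * partialWeyl (Matrix.diagonal χ) (diagonal01_mul_self χ hχ) *
        (rescale (S + S) hτu)⁻¹) * (cayley K ι h2)⁻¹) * p₂ := by
  set C : GL (ι ⊕ ι) K := cayley K ι h2 with hC
  have hform := formCongr_cayley_diagForm σ h2 S
  have hτ : (S + S).map σ = S + S := by rw [Matrix.map_add σ (map_add σ), hSσ]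
  have hτs : (S + S)ᵀ = S + S := by rw [Matrix.transpose_add, hSs]
  have hτu : IsUnit (S + S).det := by
    rw [← two_smul K S, Matrix.det_smul]
    exact ((isUnit_iff_ne_zero.2 h2).pow _).mul hSu
  -- `g' := C⁻¹ g C` lies in the anti-diagonal model `antidiag(S + S)`
  have hg' : C⁻¹ * g * C ∈ unitaryGroupOfForm σ (antidiagForm (S + S)) := by
    rw [← hform, ← conj_mem_unitaryGroupOfForm_iff]
    have : C * (C⁻¹ * g * C) * C⁻¹ = g := by group
    rw [this]; exact hg
  obtain ⟨χ, hχ, q₁, q₂, hq₁, hq₂, hq₁u, hq₂u, hfac⟩ := exists_bruhat_antidiag σ hσ hτ hτs hτu hg'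
  have hconj : ∀ q ∈ unitaryGroupOfForm σ (antidiagForm (S + S)), C * q * C⁻¹ ∈ unitaryGroupOfForm σ (diagForm S) := by
    intro q hq
    rw [conj_mem_unitaryGroupOfForm_iff, hC, hform]; exact hq
  refine ⟨χ, hχ, hτu, C * q₁ * C⁻¹, C * q₂ * C⁻¹, hconj q₁ hq₁, hconj q₂ hq₂, isSiegelSum_cayley_conj h2 hq₁u,
    isSiegelSum_cayley_conj h2 hq₂u, ?_⟩
  calc g = C * (C⁻¹ * g * C) * C⁻¹ := by group
    _ = C * (q₁ * (rescale (S + S) hτu * partialWeyl (Matrix.diagonal χ) (diagonal01_mul_self χ hχ) *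
          (rescale (S + S) hτu)⁻¹) * q₂) * C⁻¹ := by rw [hfac]
    _ = C * q₁ * C⁻¹ * (C * (rescale (S + S) hτu * partialWeyl (Matrix.diagonal χ) (diagonal01_mul_self χ hχ) *
          (rescale (S + S) hτu)⁻¹) * C⁻¹) * (C * q₂ * C⁻¹) := by group

variable {m : Type*} [Fintype m] [DecidableEq m] (e : ι ⊕ ι ≃ m)

omit [Field K] [Fintype ι] [DecidableEq ι] [Fintype m] [DecidableEq m] in
omit [Field K] [Fintype ι] [DecidableEq ι] [Fintype m] [DecidableEq m] in
/-- `reindex e.symm e.symm (reindex e e M) = M`. [folklore] -/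
private theorem reindex_symm_reindex' (M : Matrix (ι ⊕ ι) (ι ⊕ ι) K) :
    Matrix.reindex e.symm e.symm (Matrix.reindex e e M) = M := by
  simp

/-- the `P_Δ`-condition is compatible with re-enumeration along `e : ι ⊕ ι ≃ m`. [cite: HarrisKudlaSweet1996, §1 (1.11)] -/
theorem isSiegelReindex_mapEquiv_iff (p : GL (ι ⊕ ι) K) :
    IsSiegelReindex e (Units.mapEquiv (Matrix.reindexRingEquiv K e).toMulEquiv p : GL m K) ↔ IsSiegelSum p := by
  unfold IsSiegelReindex IsSiegelSum
  have : ((Units.mapEquiv (Matrix.reindexRingEquiv K e).toMulEquiv p : GL m K) : Matrix m m K) =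
      Matrix.reindex e e (p : Matrix (ι ⊕ ι) (ι ⊕ ι) K) := rfl
  rw [this, reindex_symm_reindex']

/-- **Bruhat decomposition, re-enumerated form** (`J = reindex e e (S ⊕ −S)`, e.g. `e = finSumFinEquiv`; `P_Δ` = `IsSiegelReindex e`):
every `γ ∈ U(σ, J)` is `p₁ · ψ(w) · p₂` with `p₁, p₂ ∈ P_Δ ∩ U(σ, J)`, `ψ` the re-enumeration and `w` the transported partial Weyl
element of a `0∕1`-diagonal `E`. [cite: Kudla1994, §3; HarrisKudlaSweet1996, §1 (1.12)] -/
theorem exists_bruhat_reindex (h2 : (2 : K) ≠ 0) (hσ : ∀ x, σ (σ x) = x) {S : Matrix ι ι K} (hSσ : S.map σ = S)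
    (hSs : Sᵀ = S) (hSu : IsUnit S.det) {γ : GL m K} (hγ : γ ∈ unitaryGroupOfForm σ (Matrix.reindex e e (diagForm S))) :
    ∃ (χ : ι → K) (hχ : ∀ i, χ i = 0 ∨ χ i = 1) (hτu : IsUnit (S + S).det) (p₁ p₂ : GL m K),
      p₁ ∈ unitaryGroupOfForm σ (Matrix.reindex e e (diagForm S)) ∧ p₂ ∈ unitaryGroupOfForm σ (Matrix.reindex e e (diagForm S)) ∧
      IsSiegelReindex e p₁ ∧ IsSiegelReindex e p₂ ∧
      γ = p₁ * Units.mapEquiv (Matrix.reindexRingEquiv K e).toMulEquiv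
        (cayley K ι h2 * (rescale (S + S) hτu * partialWeyl (Matrix.diagonal χ) (diagonal01_mul_self χ hχ) *
          (rescale (S + S) hτu)⁻¹) * (cayley K ι h2)⁻¹) * p₂ := by
  set ψ : GL (ι ⊕ ι) K ≃* GL m K := Units.mapEquiv (Matrix.reindexRingEquiv K e).toMulEquiv with hψ
  have hsub : (Matrix.reindex e e (diagForm S)).submatrix e e = diagForm (K := K) S := by
    rw [Matrix.reindex_apply, Matrix.submatrix_submatrix, Equiv.symm_comp_self, Matrix.submatrix_id_id]
  set g := ψ.symm γ with hgdef
  have hψg : ψ g = γ := ψ.apply_symm_apply γ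
  have hgU : g ∈ unitaryGroupOfForm σ (diagForm S) := by
    rw [← hsub, reindex_mem_unitaryGroupOfForm_iff σ e]
    show ψ g ∈ _
    rw [hψg]; exact hγ
  obtain ⟨χ, hχ, hτu, q₁, q₂, hq₁, hq₂, hq₁s, hq₂s, hfac⟩ := exists_bruhat_diag σ h2 hσ hSσ hSs hSu hgU
  have hmem : ∀ q ∈ unitaryGroupOfForm σ (diagForm S), ψ q ∈ unitaryGroupOfForm σ (Matrix.reindex e e (diagForm S)) := by
    intro q hq
    rw [← reindex_mem_unitaryGroupOfForm_iff σ e, hsub]; exact hq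
  refine ⟨χ, hχ, hτu, ψ q₁, ψ q₂, hmem q₁ hq₁, hmem q₂ hq₂, (isSiegelReindex_mapEquiv_iff e q₁).2 hq₁s,
    (isSiegelReindex_mapEquiv_iff e q₂).2 hq₂s, ?_⟩
  rw [← hψg, hfac, map_mul, map_mul]

end DiagModel

end DoubledUnitary

end Literature.NumberTheory.Automorphic
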